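import Summits.CriticalPhenomena.CardyFormulaZ2.Theorems.CardyComplexConeParafermionToSLESixFamiliesDiamondDefs
import Literature.Probability.RandomPlanarGeometry.MarkedDomainCorners
import HarnessLib

/-!
# The two boundary arcs of a Dobrushin domain are the two arcs of any boundary loop between the marks
# (line `potential-darboux-picard-diamond`, S1p `stub_boundaryDartPhase`, part 7)

Crux `ParafermionToSLESixFamilies` (stmt-CriticalPhenomena-11389), line `potential-darboux-picard-diamond`, stub
`stub_boundaryDartPhase` (S1p). The phase formula of `BoundaryDartPhase` counts the marks passed counter-clockwise
(`diamondTau`), while the type of a boundary dart (free / wired) is read off the arc `D.arc 1` / `D.arc 0` carrying its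
segment; the two must be compared although the orientation of the parametrisation `D.boundary` is not known. This file
proves the topological half: for ANY continuous `2π`-periodic loop `ℓ` onto the frontier of `D`, injective on a period
(e.g. the counter-clockwise boundary loop of a marked diamond, `exists_boundaryLoop`), the arcs `D.arc 1`, `D.arc 0` ARE the
two closed arcs of `ℓ` between the parameters of the two marks (`arcs_eq_of_loop`, registered): `D.arc 1 = ℓ [s₁, t₁]`,
`D.arc 0 = ℓ [t₁, s₁ + 2π]` with `{ℓ s₁, ℓ t₁} = {D.pt 0, D.pt 1}`, `s₁ < t₁ < s₁ + 2π`. Ingredients: a preconnected subset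
of the frontier missing two points of the loop lies in one of the two closed arcs between them (`subset_looparc_or`: the
arcs are compact, cover the frontier, and meet only in the two points — `isPreconnected_iff_subset_of_disjoint_closed`);
the arcs of `D` are preconnected, contain both marks and meet only in them (`MarkedDomain.mem_arc_inter_arc`).
Elementary topology; nothing cited.
-/

noncomputable section

namespace Summit.CriticalPhenomena.CardyFormulaZ2.Cruxes.ParafermionToSLESixFamilies.PotentialDarbouxPicardDiamond

open Set Metric Complex
open Literature.Probability.RandomPlanarGeometry

section Loop

variable {F : Set ℂ} {ℓ : ℝ → ℂ} (hcont : Continuous ℓ) (hper : ∀ s : ℝ, ℓ (s + 2 * Real.pi) = ℓ s)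
  (hrange : Set.range ℓ = F) (hinj : Set.InjOn ℓ (Ico 0 (2 * Real.pi)))

include hper in
/-- The loop is periodic. -/
theorem loop_periodic : Function.Periodic ℓ (2 * Real.pi) := hper

include hper hinj in
/-- **Injectivity on every period window**: `ℓ s = ℓ s'` with `s, s' ∈ [a, a + 2π)` forces `s = s'`. -/
theorem loop_injOn_window (a : ℝ) {s s' : ℝ} (hs : s ∈ Ico a (a + 2 * Real.pi)) (hs' : s' ∈ Ico a (a + 2 * Real.pi))
    (h : ℓ s = ℓ s') : s = s' := by
  have hp : Function.Periodic ℓ (2 * Real.pi) := hper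
  have h2π := Real.two_pi_pos
  obtain ⟨hy, z, hz⟩ := (toIcoMod_eq_iff h2π).1 (rfl : toIcoMod h2π 0 s = toIcoMod h2π 0 s)
  obtain ⟨hy', z', hz'⟩ := (toIcoMod_eq_iff h2π).1 (rfl : toIcoMod h2π 0 s' = toIcoMod h2π 0 s')
  set y := toIcoMod h2π 0 s with hydef
  set y' := toIcoMod h2π 0 s' with hy'def
  rw [zero_add] at hy hy'
  have hly : ℓ y = ℓ s := by
    rw [show y = s - z • (2 * Real.pi) by rw [hz]; ring]; exact hp.sub_zsmul_eq z
  have hly' : ℓ y' = ℓ s' := by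
    rw [show y' = s' - z' • (2 * Real.pi) by rw [hz']; ring]; exact hp.sub_zsmul_eq z'
  have hyy : y = y' := hinj hy hy' (by rw [hly, hly', h])
  have hzz : ((z - z' : ℤ) : ℝ) * (2 * Real.pi) = s - s' := by
    have e1 : s = y + z * (2 * Real.pi) := by rw [hz, zsmul_eq_mul]
    have e2 : s' = y' + z' * (2 * Real.pi) := by rw [hz', zsmul_eq_mul]
    rw [e1, e2, hyy]; push_cast; ring
  have hlt : |s - s'| < 2 * Real.pi := by
    rw [abs_lt]; constructor <;> linarith [hs.1, hs.2, hs'.1, hs'.2]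
  rw [← hzz, abs_lt] at hlt
  have h1 : ((z - z' : ℤ) : ℝ) < 1 := by nlinarith
  have h2 : (-1 : ℝ) < ((z - z' : ℤ) : ℝ) := by nlinarith
  have h3 : z - z' = 0 := by
    have h1' : (z - z' : ℤ) < 1 := by exact_mod_cast h1
    have h2' : (-1 : ℤ) < z - z' := by exact_mod_cast h2
    omega
  have : s - s' = 0 := by rw [← hzz, h3]; simp
  linarith

include hper hrange in
/-- Every point of the frontier has a parameter in every period window. -/
theorem loop_exists_param {z : ℂ} (hz : z ∈ F) (a : ℝ) : ∃ s ∈ Ico a (a + 2 * Real.pi), ℓ s = z := by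
  have hp : Function.Periodic ℓ (2 * Real.pi) := hper
  rw [← hrange] at hz
  obtain ⟨s₀, rfl⟩ := hz
  obtain ⟨y, hy, hys⟩ := hp.exists_mem_Ico Real.two_pi_pos s₀ a
  exact ⟨y, hy, hys.symm⟩

include hper in
/-- Shifting a parameter interval by a period does not change its image. -/
theorem loop_image_Icc_add (u v : ℝ) : ℓ '' Icc (u + 2 * Real.pi) (v + 2 * Real.pi) = ℓ '' Icc u v := by
  ext z
  constructor
  · rintro ⟨s, hs, rfl⟩
    refine ⟨s - 2 * Real.pi, ⟨by linarith [hs.1], by linarith [hs.2]⟩, ?_⟩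
    have := hper (s - 2 * Real.pi); rw [sub_add_cancel] at this; exact this.symm
  · rintro ⟨s, hs, rfl⟩
    exact ⟨s + 2 * Real.pi, ⟨by linarith [hs.1], by linarith [hs.2]⟩, hper s⟩

include hcont hper hrange hinj in
/-- **A preconnected subset of the frontier missing two points of the loop lies in one of the two closed arcs between
them.** -/
theorem subset_looparc_or {S : Set ℂ} (hS : IsPreconnected S) (hSF : S ⊆ F) {a b : ℝ} (hab : a < b)
    (hba : b < a + 2 * Real.pi) (ha : ℓ a ∉ S) (hb : ℓ b ∉ S) :
    S ⊆ ℓ '' Icc a b ∨ S ⊆ ℓ '' Icc b (a + 2 * Real.pi) := by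
  refine isPreconnected_iff_subset_of_disjoint_closed.1 hS _ _ ((isCompact_Icc.image hcont).isClosed)
    ((isCompact_Icc.image hcont).isClosed) (fun z hz => ?_) ?_
  · obtain ⟨s, hs, rfl⟩ := loop_exists_param hper hrange (hSF hz) a
    rcases le_or_gt s b with h | h
    · exact Or.inl ⟨s, ⟨hs.1, h⟩, rfl⟩
    · exact Or.inr ⟨s, ⟨h.le, hs.2.le⟩, rfl⟩
  · ext z
    simp only [mem_inter_iff, mem_empty_iff_false, iff_false, not_and]
    rintro hz ⟨s, hs, rfl⟩ ⟨s', hs', hss'⟩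
    rcases hs'.2.lt_or_eq with h | h
    · have := loop_injOn_window hper hinj a ⟨hs.1, by linarith [hs.2]⟩ ⟨by linarith [hs'.1], h⟩ hss'.symm
      have hsb : s = b := le_antisymm hs.2 (this ▸ hs'.1)
      exact hb (hsb ▸ hz)
    · rw [h, hper] at hss'
      exact ha (hss' ▸ hz)

include hcont hper hrange hinj in
/-- **A preconnected subset of the frontier containing two points of the loop contains one of the two closed arcs between
them.** -/
theorem looparc_subset_or {S : Set ℂ} (hS : IsPreconnected S) (hSF : S ⊆ F) {a b : ℝ} (hab : a < b)
    (hba : b < a + 2 * Real.pi) (ha : ℓ a ∈ S) (hb : ℓ b ∈ S) :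
    ℓ '' Icc a b ⊆ S ∨ ℓ '' Icc b (a + 2 * Real.pi) ⊆ S := by
  by_contra h
  rw [not_or, not_subset, not_subset] at h
  obtain ⟨⟨_, ⟨s, hs, rfl⟩, hsS⟩, ⟨_, ⟨s', hs', rfl⟩, hs'S⟩⟩ := h
  have hsa : a < s := lt_of_le_of_ne hs.1 (by rintro rfl; exact hsS ha)
  have hsb : s < b := lt_of_le_of_ne hs.2 (by rintro rfl; exact hsS hb)
  have hs'b : b < s' := lt_of_le_of_ne hs'.1 (by rintro rfl; exact hs'S hb)
  have hs'a : s' < a + 2 * Real.pi := lt_of_le_of_ne hs'.2 (by rintro h; rw [h, hper] at hs'S; exact hs'S ha)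
  rcases subset_looparc_or hcont hper hrange hinj hS hSF (hsb.trans hs'b) (by linarith) hsS hs'S with h | h
  · obtain ⟨r, hr, hra⟩ := h ha
    have := loop_injOn_window hper hinj a ⟨le_rfl, by linarith [Real.two_pi_pos]⟩ ⟨by linarith [hr.1], by linarith [hr.2]⟩ hra.symm
    linarith [hr.1]
  · obtain ⟨r, hr, hrb⟩ := h hb
    have := loop_injOn_window hper hinj b ⟨le_rfl, by linarith [Real.two_pi_pos]⟩ ⟨by linarith [hr.1], by linarith [hr.2]⟩ hrb.symm
    linarith [hr.1]

end Loop

/-! ## The arcs of a Dobrushin domain along a boundary loop -/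

section Dobrushin

variable {D : DobrushinDomain} {ℓ : ℝ → ℂ} (hcont : Continuous ℓ) (hper : ∀ s : ℝ, ℓ (s + 2 * Real.pi) = ℓ s)
  (hrange : Set.range ℓ = frontier D.carrier) (hinj : Set.InjOn ℓ (Ico 0 (2 * Real.pi)))

/-- The arcs of a marked domain are preconnected. -/
theorem isPreconnected_arc (i : Fin 2) : IsPreconnected (D.arc i) :=
  isPreconnected_Icc.image _ D.continuous_boundary.continuousOn

/-- Both marks of a Dobrushin domain lie on both arcs. -/
theorem pt_mem_arc (m i : Fin 2) : D.pt m ∈ D.arc i := by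
  rw [MarkedDomain.pt_mem_arc_iff]
  fin_cases m <;> fin_cases i <;> decide

include hcont hper hrange hinj in
/-- **The arcs of a Dobrushin domain are the two loop arcs between the marks** (ordered parameters `0 ≤ a < b < 2π` of
the two marks). -/
theorem arcs_eq_of_loop_of_lt {a b : ℝ} (h0a : 0 ≤ a) (hab : a < b) (hb2 : b < 2 * Real.pi)
    (hmarks : ∀ j : Fin 2, D.pt j = ℓ a ∨ D.pt j = ℓ b) (ha : ∃ j : Fin 2, ℓ a = D.pt j) (hb : ∃ j : Fin 2, ℓ b = D.pt j) :
    (D.arc 1 = ℓ '' Icc a b ∧ D.arc 0 = ℓ '' Icc b (a + 2 * Real.pi)) ∨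
      (D.arc 1 = ℓ '' Icc b (a + 2 * Real.pi) ∧ D.arc 0 = ℓ '' Icc a b) := by
  have h2π := Real.two_pi_pos
  have hba : b < a + 2 * Real.pi := by linarith
  obtain ⟨ja, hja⟩ := ha
  obtain ⟨jb, hjb⟩ := hb
  have hmem : ∀ i : Fin 2, ℓ a ∈ D.arc i ∧ ℓ b ∈ D.arc i := fun i => ⟨hja ▸ pt_mem_arc ja i, hjb ▸ pt_mem_arc jb i⟩
  have hsub : ∀ i : Fin 2, D.arc i ⊆ frontier D.carrier := fun i => D.arc_subset_frontier i
  have hcov : ∀ i : Fin 2, ℓ '' Icc a b ⊆ D.arc i ∨ ℓ '' Icc b (a + 2 * Real.pi) ⊆ D.arc i := fun i =>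
    looparc_subset_or hcont hper hrange hinj (isPreconnected_arc i) (hsub i) hab hba (hmem i).1 (hmem i).2
  -- a common point of the two arcs is `ℓ a` or `ℓ b`
  have hcommon : ∀ z : ℂ, z ∈ D.arc 1 → z ∈ D.arc 0 → z = ℓ a ∨ z = ℓ b := by
    intro z h1 h0
    rcases D.mem_arc_inter_arc (i := 1) (k := 0) (by decide) h1 h0 with h | h
    · rw [h]; exact hmarks 1
    · rw [h]; exact hmarks (1 + 1)
  -- the two arcs do not contain the same loop arc
  have hexcl₁ : ¬ (ℓ '' Icc a b ⊆ D.arc 1 ∧ ℓ '' Icc a b ⊆ D.arc 0) := by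
    rintro ⟨h1, h0⟩
    set m := (a + b) / 2 with hm
    have hmI : m ∈ Icc a b := ⟨by rw [hm]; linarith, by rw [hm]; linarith⟩
    have hmw : m ∈ Ico 0 (2 * Real.pi) := ⟨by rw [hm]; linarith, by rw [hm]; linarith⟩
    rcases hcommon _ (h1 ⟨m, hmI, rfl⟩) (h0 ⟨m, hmI, rfl⟩) with h | h
    · have := hinj hmw ⟨h0a, by linarith⟩ h; rw [hm] at this; linarith
    · have := hinj hmw ⟨by linarith, hb2⟩ h; rw [hm] at this; linarith
  have hexcl₂ : ¬ (ℓ '' Icc b (a + 2 * Real.pi) ⊆ D.arc 1 ∧ ℓ '' Icc b (a + 2 * Real.pi) ⊆ D.arc 0) := by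
    rintro ⟨h1, h0⟩
    set m := (b + (a + 2 * Real.pi)) / 2 with hm
    have hmI : m ∈ Icc b (a + 2 * Real.pi) := ⟨by rw [hm]; linarith, by rw [hm]; linarith⟩
    have hmw : m ∈ Ico b (b + 2 * Real.pi) := ⟨by rw [hm]; linarith, by rw [hm]; linarith⟩
    rcases hcommon _ (h1 ⟨m, hmI, rfl⟩) (h0 ⟨m, hmI, rfl⟩) with h | h
    · rw [← hper a] at h
      have := loop_injOn_window hper hinj b hmw ⟨hba.le, by linarith⟩ h; rw [hm] at this; linarith
    · have := loop_injOn_window hper hinj b hmw ⟨le_rfl, by linarith⟩ h; rw [hm] at this; linarith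
  -- from the coverings to the equalities
  have haI : ℓ a ∈ ℓ '' Icc a b := ⟨a, left_mem_Icc.2 hab.le, rfl⟩
  have hbI : ℓ b ∈ ℓ '' Icc a b := ⟨b, right_mem_Icc.2 hab.le, rfl⟩
  have haJ : ℓ a ∈ ℓ '' Icc b (a + 2 * Real.pi) := ⟨a + 2 * Real.pi, right_mem_Icc.2 hba.le, hper a⟩
  have hbJ : ℓ b ∈ ℓ '' Icc b (a + 2 * Real.pi) := ⟨b, left_mem_Icc.2 hba.le, rfl⟩
  have heqI : ∀ i i' : Fin 2, i ≠ i' → ℓ '' Icc a b ⊆ D.arc i → ℓ '' Icc b (a + 2 * Real.pi) ⊆ D.arc i' →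
      D.arc i = ℓ '' Icc a b := by
    intro i i' hii' hi hi'
    refine Subset.antisymm (fun z hz => ?_) hi
    obtain ⟨s, hs, rfl⟩ := loop_exists_param hper hrange (hsub i hz) a
    rcases le_or_gt s b with h | h
    · exact ⟨s, ⟨hs.1, h⟩, rfl⟩
    · have hz' : ℓ s ∈ D.arc i' := hi' ⟨s, ⟨h.le, hs.2.le⟩, rfl⟩
      have : ℓ s ∈ D.arc 1 ∧ ℓ s ∈ D.arc 0 := by
        fin_cases i <;> fin_cases i' <;> simp at hii' <;> exact ⟨by assumption, by assumption⟩
      rcases hcommon _ this.1 this.2 with h' | h'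
      · rw [h']; exact haI
      · rw [h']; exact hbI
  have heqJ : ∀ i i' : Fin 2, i ≠ i' → ℓ '' Icc b (a + 2 * Real.pi) ⊆ D.arc i → ℓ '' Icc a b ⊆ D.arc i' →
      D.arc i = ℓ '' Icc b (a + 2 * Real.pi) := by
    intro i i' hii' hi hi'
    refine Subset.antisymm (fun z hz => ?_) hi
    obtain ⟨s, hs, rfl⟩ := loop_exists_param hper hrange (hsub i hz) a
    rcases lt_or_ge s b with h | h
    · have hz' : ℓ s ∈ D.arc i' := hi' ⟨s, ⟨hs.1, h.le⟩, rfl⟩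
      have : ℓ s ∈ D.arc 1 ∧ ℓ s ∈ D.arc 0 := by
        fin_cases i <;> fin_cases i' <;> simp at hii' <;> exact ⟨by assumption, by assumption⟩
      rcases hcommon _ this.1 this.2 with h' | h'
      · rw [h']; exact haJ
      · rw [h']; exact hbJ
    · exact ⟨s, ⟨h, hs.2.le⟩, rfl⟩
  rcases hcov 1 with h1 | h1 <;> rcases hcov 0 with h0 | h0
  · exact absurd ⟨h1, h0⟩ hexcl₁
  · exact Or.inl ⟨heqI 1 0 (by decide) h1 h0, heqJ 0 1 (by decide) h0 h1⟩
  · exact Or.inr ⟨heqJ 1 0 (by decide) h1 h0, heqI 0 1 (by decide) h0 h1⟩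
  · exact absurd ⟨h1, h0⟩ hexcl₂

end Dobrushin

/-- **The two boundary arcs of a Dobrushin domain are the two arcs of any boundary loop between the marks** (registered
helper of `stub_boundaryDartPhase`). See the module docstring. -/
theorem arcs_eq_of_loop : ∀ (D : DobrushinDomain) (ℓ : ℝ → ℂ), Continuous ℓ → (∀ s : ℝ, ℓ (s + 2 * Real.pi) = ℓ s) → Set.range ℓ = frontier D.carrier → Set.InjOn ℓ (Set.Ico 0 (2 * Real.pi)) → ∃ s₁ t₁ : ℝ, s₁ < t₁ ∧ t₁ < s₁ + 2 * Real.pi ∧ ((ℓ s₁ = D.pt 0 ∧ ℓ t₁ = D.pt 1) ∨ (ℓ s₁ = D.pt 1 ∧ ℓ t₁ = D.pt 0)) ∧ D.arc 1 = ℓ '' Set.Icc s₁ t₁ ∧ D.arc 0 = ℓ '' Set.Icc t₁ (s₁ + 2 * Real.pi) := by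
  intro D ℓ hcont hper hrange hinj
  have h2π := Real.two_pi_pos
  obtain ⟨τ₀, hτ₀, hl₀⟩ := loop_exists_param hper hrange (D.pt_mem_frontier 0) 0
  obtain ⟨τ₁, hτ₁, hl₁⟩ := loop_exists_param hper hrange (D.pt_mem_frontier 1) 0
  rw [zero_add] at hτ₀ hτ₁
  have hne : τ₀ ≠ τ₁ := by
    rintro rfl
    have := D.pt_injective (hl₀.symm.trans hl₁)
    exact absurd this (by decide)
  -- order the two parameters
  have key : ∀ {a b : ℝ} (ja jb : Fin 2), ja ≠ jb → ℓ a = D.pt ja → ℓ b = D.pt jb → 0 ≤ a → a < b → b < 2 * Real.pi →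
      ∃ s₁ t₁ : ℝ, s₁ < t₁ ∧ t₁ < s₁ + 2 * Real.pi ∧ ((ℓ s₁ = D.pt 0 ∧ ℓ t₁ = D.pt 1) ∨ (ℓ s₁ = D.pt 1 ∧ ℓ t₁ = D.pt 0)) ∧
        D.arc 1 = ℓ '' Icc s₁ t₁ ∧ D.arc 0 = ℓ '' Icc t₁ (s₁ + 2 * Real.pi) := by
    intro a b ja jb hj hja hjb h0a hab hb2
    have hmarks : ∀ j : Fin 2, D.pt j = ℓ a ∨ D.pt j = ℓ b := by
      intro j
      fin_cases ja <;> fin_cases jb <;> simp at hj <;> fin_cases j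
      · exact Or.inl hja.symm
      · exact Or.inr hjb.symm
      · exact Or.inr hjb.symm
      · exact Or.inl hja.symm
    rcases arcs_eq_of_loop_of_lt hcont hper hrange hinj h0a hab hb2 hmarks ⟨ja, hja⟩ ⟨jb, hjb⟩ with ⟨h1, h0⟩ | ⟨h1, h0⟩
    · refine ⟨a, b, hab, by linarith, ?_, h1, h0⟩
      fin_cases ja <;> fin_cases jb <;> simp at hj
      · exact Or.inl ⟨hja, hjb⟩
      · exact Or.inr ⟨hja, hjb⟩
    · refine ⟨b, a + 2 * Real.pi, by linarith, by linarith, ?_, h1, ?_⟩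
      · rw [hper]
        fin_cases ja <;> fin_cases jb <;> simp at hj
        · exact Or.inr ⟨hjb, hja⟩
        · exact Or.inl ⟨hjb, hja⟩
      · rw [show b + 2 * Real.pi = b + 2 * Real.pi from rfl, loop_image_Icc_add hper]; exact h0
  rcases lt_or_gt_of_ne hne with h | h
  · exact key 0 1 (by decide) hl₀ hl₁ hτ₀.1 h hτ₁.2
  · exact key 1 0 (by decide) hl₁ hl₀ hτ₁.1 h hτ₀.2

end Summit.CriticalPhenomena.CardyFormulaZ2.Cruxes.ParafermionToSLESixFamilies.PotentialDarbouxPicardDiamond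

end
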